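import Summits.ValiantsHypothesis.ValiantsHypothesis.Theorems.LacunarySymmetroidMatrixDescartesGraftToolkit

/-!
# `MatrixDescartes` — THE TAIL GRAFT (m = 2): a rank-one END letter is worth one more alternation AT THE SAME FORMAT

HONEST FRAMING.  Ideator seat `val-idea-5` (gen 2), crux `Theses.LacunarySymmetroid.MatrixDescartes` (stmt-ValiantsHypothesis-18050).
LOWER-bound / construction mathematics in census currency; it proves NOTHING about the crux (an upper-bound statement), nothing about
`DoorA26` / `DoorA34`, nothing about `VP ≠ VNP`.  No `sorry`, no new definition.

LOCATED ORIGIN (HOME `lawfit/seam/tails.py`, exact rationals on the kernel seed integers).  The END letters of the m = 2 census seeds are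
numerically RANK ONE (|λ_min/λ_max| = 10⁻¹³ … 10⁻¹⁷⁶) and the tiny rank-2 TAIL of each end letter carries exactly the extreme root: singularising
the top letter of G18 by a 10⁻¹⁷⁶ relative perturbation deletes the root at x ≈ 47.9 (18 → 17), G25 loses its smallest / largest root under the
bottom / top singularisation (25 → 24 → 23).  The theorem below is the mechanism, read constructively.

THE TAIL GRAFT (`exists_alternating_tail_top`).  Let `F = ∑ l, X^(d l) • S l` (`K+1` real symmetric 2×2 letters, `d` strictly increasing) have a
top letter `J = S last` of rank EXACTLY one (`det J = 0`, `J ≠ 0`, hence `tr J ≠ 0`), and an alternation certificate `0 < τ 0 < ⋯ < τ N`.  Thicken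
the top letter: `J_s = J + s·1`.  Then `det F_s(x) = det F(x) + s·x^D·tr F(x) + s²·x^(2D)` (`D = d last`); at the old points `det F_s(τ j) → det F(τ j)`
as `s → 0`, while for FIXED `s` the new top coefficient `det J_s = s (s + tr J)` — of either sign at will, by the sign of `s` — dominates as `x → ∞`
(`x^(−D) F_s(x) → J_s`).  Choosing `sign (s·tr J) = − sign det F(τ N)` and then `x⋆` large gives `N + 1` alternations with the SAME support and the
same number of letters: **a rank-one top letter is worth `+1` at the same format** (`not_posRootLawAt_of_tail_top`).  §4 is the mirror at the
bottom end (`x → 0⁺`, `exists_alternating_tail_bottom`) and the two-ended corollary `not_posRootLawAt_of_tail_both`: **rank-one ENDS are worth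
`+2` at the same format** — an `N`-alternation certificate on a `(2, K+1)` pencil with both end letters of rank exactly one refutes
`PosRootLawAt 2 (K+1) (N+1)`.  For general `m` an end letter of corank `c` should be worth `+c` (thicken one kernel direction at a time at graded
scales — exactly the graded-threshold letter of the kernel GRAFT LAW, and what the (3,5)/(4,4) flag objects' end spectra show: m − 1 eigenvalues
at 10⁻⁸¹…10⁻⁸³ relative); not typed here.  CONTRAPOSITIVE READING for constrained sub-censuses (the desk's 08-29 strata): pencils with EXACTLY
rank-one end letters stay at least 2 below the alternation record of their format — at (2,5), if 14 is the record, a rank-one-ended pencil with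
13 simple positive roots would be a census event (15 at (2,5)).  [folklore] (continuity of `det`, dominance of the extreme coefficient).
-/

set_option linter.dupNamespace false

namespace Summit.ValiantsHypothesis.ValiantsHypothesis.Cruxes.MatrixDescartes.TailGraft

open Matrix Finset Filter Topology
open Summit.ValiantsHypothesis.ValiantsHypothesis.Theorems.LacunarySymmetroidMatrixDescartes.Census.Graft

/-! ## 1. Two-by-two bookkeeping -/

/-- `det (M + t·1) = det M + t·tr M + t²` for 2×2 matrices. [folklore] -/
theorem det_add_smul_one_two (M : Matrix (Fin 2) (Fin 2) ℝ) (t : ℝ) :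
    (M + t • (1 : Matrix (Fin 2) (Fin 2) ℝ)).det = M.det + t * M.trace + t ^ 2 := by
  simp [Matrix.det_fin_two, Matrix.trace_fin_two]
  ring

/-- A nonzero symmetric 2×2 matrix with `det = 0` has nonzero trace. [folklore] -/
theorem trace_ne_zero_of_det_eq_zero {M : Matrix (Fin 2) (Fin 2) ℝ} (hM : M.IsSymm) (hdet : M.det = 0) (hne : M ≠ 0) :
    M.trace ≠ 0 := by
  intro htr
  have h10 : M 1 0 = M 0 1 := by
    have := congrFun (congrFun hM 0) 1
    simpa [Matrix.transpose_apply] using this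
  rw [Matrix.det_fin_two, h10] at hdet
  rw [Matrix.trace_fin_two] at htr
  have h00 : M 0 0 = 0 := by nlinarith [sq_nonneg (M 0 0), sq_nonneg (M 0 1)]
  have h01 : M 0 1 = 0 := by nlinarith [sq_nonneg (M 0 0), sq_nonneg (M 0 1)]
  have h11 : M 1 1 = 0 := by linarith
  apply hne
  ext i j
  fin_cases i <;> fin_cases j <;> simp [h00, h01, h10, h11]

/-- Evaluating the thickened pencil: updating the letter `i` by `+ B` adds `x^(d i) • B`. [folklore] -/
theorem sum_smul_update_add {K : ℕ} {n : Type*} [Fintype n] [DecidableEq n] (d : Fin (K + 1) → ℕ)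
    (S : Fin (K + 1) → Matrix n n ℝ) (i : Fin (K + 1)) (B : Matrix n n ℝ) (x : ℝ) :
    (∑ l, x ^ d l • Function.update S i (S i + B) l) = (∑ l, x ^ d l • S l) + x ^ d i • B := by
  have h : ∀ l, x ^ d l • Function.update S i (S i + B) l = x ^ d l • S l + (if l = i then x ^ d i • B else 0) := by
    intro l
    by_cases hl : l = i
    · subst hl; simp [smul_add]
    · simp [hl]
  simp_rw [h, Finset.sum_add_distrib, Finset.sum_ite_eq', Finset.mem_univ, if_true]

/-! ## 2. The dying of the lower letters after division by `x^D` -/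

/-- For `x → ∞`, `x^(d l) / x^D → [l = last]` when `d` is strictly increasing with top value `D = d last`. [folklore] -/
theorem tendsto_pow_div_top {K : ℕ} (d : Fin (K + 1) → ℕ) (hd : StrictMono d) (l : Fin (K + 1)) :
    Tendsto (fun x : ℝ => x ^ d l * (x ^ d (Fin.last K))⁻¹) atTop
      (𝓝 (if l = Fin.last K then (1 : ℝ) else 0)) := by
  by_cases hl : l = Fin.last K
  · subst hl
    simp only [if_true]
    refine tendsto_const_nhds.congr' ?_
    filter_upwards [eventually_gt_atTop (0 : ℝ)] with x hx
    rw [mul_inv_cancel₀ (pow_ne_zero _ hx.ne')]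
  · simp only [hl, if_false]
    have hlt : d l < d (Fin.last K) := hd (lt_of_le_of_ne (Fin.le_last l) hl)
    have hk : d (Fin.last K) - d l ≠ 0 := by omega
    have h0 : Tendsto (fun x : ℝ => (x ^ (d (Fin.last K) - d l))⁻¹) atTop (𝓝 0) :=
      tendsto_inv_atTop_zero.comp (tendsto_pow_atTop hk)
    refine h0.congr' ?_
    filter_upwards [eventually_gt_atTop (0 : ℝ)] with x hx
    rw [pow_sub₀ _ hx.ne' hlt.le, mul_inv, inv_inv, mul_comm]

/-- After division by `x^D` the pencil tends to its top letter. [folklore] -/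
theorem tendsto_inv_pow_smul_pencil {K : ℕ} (d : Fin (K + 1) → ℕ) (hd : StrictMono d)
    (S : Fin (K + 1) → Matrix (Fin 2) (Fin 2) ℝ) :
    Tendsto (fun x : ℝ => (x ^ d (Fin.last K))⁻¹ • ∑ l, x ^ d l • S l) atTop (𝓝 (S (Fin.last K))) := by
  have h : ∀ x : ℝ, (x ^ d (Fin.last K))⁻¹ • (∑ l, x ^ d l • S l) = ∑ l, (x ^ d l * (x ^ d (Fin.last K))⁻¹) • S l := by
    intro x
    rw [Finset.smul_sum]
    refine Finset.sum_congr rfl fun l _ => ?_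
    rw [smul_smul, mul_comm]
  simp_rw [h]
  have hlim : S (Fin.last K) = ∑ l, (if l = Fin.last K then (1 : ℝ) else 0) • S l := by
    simp [ite_smul, Finset.sum_ite_eq']
  rw [hlim]
  exact tendsto_finsetSum _ fun l _ => (tendsto_pow_div_top d hd l).smul_const _

/-! ## 3. The tail graft at the top end -/

/-- **THE TAIL GRAFT (m = 2, top end).**  A rank-one top letter is worth one more alternation at the same format: see the module
docstring.  The thickened letter is `S last + s • 1`; all other letters, all exponents and all old test points are kept. [folklore] -/
theorem exists_alternating_tail_top {K N : ℕ} (d : Fin (K + 1) → ℕ) (S : Fin (K + 1) → Matrix (Fin 2) (Fin 2) ℝ)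
    (hd : StrictMono d) (hS : ∀ l, (S l).IsSymm)
    (hdet : (S (Fin.last K)).det = 0) (hne0 : S (Fin.last K) ≠ 0)
    (τ : Fin (N + 1) → ℝ) (hτ : StrictMono τ) (hpos : ∀ j, 0 < τ j)
    (hne : ∀ j, (∑ l, τ j ^ d l • S l).det ≠ 0)
    (halt : ∀ j : Fin N, (∑ l, τ j.castSucc ^ d l • S l).det * (∑ l, τ j.succ ^ d l • S l).det < 0) :
    ∃ (s : ℝ) (τ' : Fin (N + 1 + 1) → ℝ),
      (∀ l, (Function.update S (Fin.last K) (S (Fin.last K) + s • (1 : Matrix (Fin 2) (Fin 2) ℝ)) l).IsSymm) ∧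
      StrictMono τ' ∧ (∀ j, 0 < τ' j) ∧
      (∀ j, (∑ l, τ' j ^ d l • Function.update S (Fin.last K) (S (Fin.last K) + s • (1 : Matrix (Fin 2) (Fin 2) ℝ)) l).det ≠ 0) ∧
      ∀ j : Fin (N + 1),
        (∑ l, τ' j.castSucc ^ d l • Function.update S (Fin.last K) (S (Fin.last K) + s • (1 : Matrix (Fin 2) (Fin 2) ℝ)) l).det *
        (∑ l, τ' j.succ ^ d l • Function.update S (Fin.last K) (S (Fin.last K) + s • (1 : Matrix (Fin 2) (Fin 2) ℝ)) l).det < 0 := by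
  classical
  -- names
  set J : Matrix (Fin 2) (Fin 2) ℝ := S (Fin.last K) with hJ
  set D : ℕ := d (Fin.last K) with hD
  set G : ℝ → Matrix (Fin 2) (Fin 2) ℝ := fun x => ∑ l, x ^ d l • S l with hG
  have hT : J.trace ≠ 0 := trace_ne_zero_of_det_eq_zero (hS _) hdet hne0
  set dN : ℝ := (G (τ (Fin.last N))).det with hdN
  have hdN0 : dN ≠ 0 := hne (Fin.last N)
  -- the thickened pencil evaluated: `G x + (s * x^D) • 1`
  have hGs : ∀ s x : ℝ, (∑ l, x ^ d l • Function.update S (Fin.last K) (S (Fin.last K) + s • (1 : Matrix (Fin 2) (Fin 2) ℝ)) l)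
      = G x + (s * x ^ D) • (1 : Matrix (Fin 2) (Fin 2) ℝ) := by
    intro s x
    rw [sum_smul_update_add, smul_smul, mul_comm]
  -- the scale `s(t) = -t·(dN·tr J)`; Step 1: small `t > 0` keeps every old sign and makes `1 - t·dN > 0`
  have hold : ∀ j : Fin (N + 1), ∀ᶠ t : ℝ in 𝓝 0,
      0 < (G (τ j) + ((-(t * (dN * J.trace))) * τ j ^ D) • (1 : Matrix (Fin 2) (Fin 2) ℝ)).det * (G (τ j)).det := by
    intro j
    have hsc : Continuous fun t : ℝ => (-(t * (dN * J.trace))) * τ j ^ D :=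
      (continuous_id.mul continuous_const).neg.mul continuous_const
    have hc : Continuous fun t : ℝ => (G (τ j) + ((-(t * (dN * J.trace))) * τ j ^ D) • (1 : Matrix (Fin 2) (Fin 2) ℝ)).det :=
      (continuous_const.add (hsc.smul continuous_const)).matrix_det
    have ht := hc.tendsto 0
    simp only [zero_mul, neg_zero, zero_smul, add_zero] at ht
    exact eventually_mul_pos_of_tendsto ht (hne j)
  have hone : ∀ᶠ t : ℝ in 𝓝 0, 0 < 1 - t * dN := by
    have hc : Tendsto (fun t : ℝ => 1 - t * dN) (𝓝 0) (𝓝 1) := by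
      have h := (tendsto_const_nhds (x := (1 : ℝ)) (f := 𝓝 (0 : ℝ))).sub
        ((Filter.tendsto_id (x := 𝓝 (0 : ℝ))).mul (tendsto_const_nhds (x := dN)))
      simpa using h
    have := eventually_mul_pos_of_tendsto hc one_ne_zero
    simpa using this
  obtain ⟨t, ⟨htall, ht1⟩, htpos⟩ :=
    ((((eventually_all.2 hold).and hone).filter_mono nhdsWithin_le_nhds).and
      (eventually_mem_nhdsWithin : ∀ᶠ t : ℝ in 𝓝[Set.Ioi 0] 0, t ∈ Set.Ioi 0)).exists
  rw [Set.mem_Ioi] at htpos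
  set s : ℝ := -(t * (dN * J.trace)) with hs
  -- the new top coefficient and its sign
  set L : ℝ := (J + s • (1 : Matrix (Fin 2) (Fin 2) ℝ)).det with hL
  have hLval : L = s * (s + J.trace) := by
    rw [hL, det_add_smul_one_two, hdet]; ring
  have hLdN : L * dN < 0 := by
    rw [hLval, hs]
    have h1 : 0 < (dN * J.trace) * (dN * J.trace) := mul_self_pos.mpr (mul_ne_zero hdN0 hT)
    have key : 0 < t * ((dN * J.trace) * (dN * J.trace)) * (1 - t * dN) := mul_pos (mul_pos htpos h1) ht1
    have e : (-(t * (dN * J.trace))) * ((-(t * (dN * J.trace))) + J.trace) * dN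
        = -(t * ((dN * J.trace) * (dN * J.trace)) * (1 - t * dN)) := by ring
    rw [e]; linarith
  have hL0 : L ≠ 0 := fun h => by rw [h, zero_mul] at hLdN; exact lt_irrefl 0 hLdN
  -- Step 2: for this `s`, the sign of `det F_s(x)` at large `x` is the sign of `L`
  have hlim : Tendsto (fun x : ℝ => ((x ^ D)⁻¹ • (G x + (s * x ^ D) • (1 : Matrix (Fin 2) (Fin 2) ℝ))).det) atTop (𝓝 L) := by
    have h1 : Tendsto (fun x : ℝ => (x ^ D)⁻¹ • G x + s • (1 : Matrix (Fin 2) (Fin 2) ℝ)) atTop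
        (𝓝 (J + s • (1 : Matrix (Fin 2) (Fin 2) ℝ))) :=
      (tendsto_inv_pow_smul_pencil d hd S).add tendsto_const_nhds
    have h2 := ((continuous_id.matrix_det).tendsto _).comp h1
    refine h2.congr' ?_
    filter_upwards [eventually_gt_atTop (0 : ℝ)] with x hx
    simp only [Function.comp, id]
    rw [smul_add, smul_smul, show (x ^ D)⁻¹ * (s * x ^ D) = s by field_simp]
  obtain ⟨xs, ⟨hxsL, hxsN⟩, hxs0⟩ :=
    (((eventually_mul_pos_of_tendsto hlim hL0).and (eventually_gt_atTop (τ (Fin.last N)))).and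
      (eventually_gt_atTop (0 : ℝ))).exists
  have hxsL' : 0 < (G xs + (s * xs ^ D) • (1 : Matrix (Fin 2) (Fin 2) ℝ)).det * L := by
    have hc : ((xs ^ D)⁻¹ • (G xs + (s * xs ^ D) • (1 : Matrix (Fin 2) (Fin 2) ℝ))).det
        = ((xs ^ D)⁻¹) ^ 2 * (G xs + (s * xs ^ D) • (1 : Matrix (Fin 2) (Fin 2) ℝ)).det := by
      rw [Matrix.det_smul, Fintype.card_fin]
    rw [hc] at hxsL
    have hp : 0 < ((xs ^ D)⁻¹) ^ 2 := pow_pos (inv_pos.2 (pow_pos hxs0 _)) 2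
    nlinarith [hxsL, hp, mul_pos hp hp]
  -- the new test points
  set τ' : Fin (N + 1 + 1) → ℝ := Fin.snoc τ xs with hτ'
  have hτ'c : ∀ j : Fin (N + 1), τ' j.castSucc = τ j := fun j => by simp [hτ']
  have hτ'l : τ' (Fin.last (N + 1)) = xs := by simp [hτ']
  refine ⟨s, τ', ?_, ?_, ?_, ?_, ?_⟩
  · -- symmetry
    intro l
    by_cases hl : l = Fin.last K
    · subst hl
      rw [Function.update_self]
      exact (hS _).add ((Matrix.isSymm_one).smul s)
    · rw [Function.update_of_ne hl]; exact hS l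
  · -- strict monotonicity
    refine Fin.strictMono_iff_lt_succ.mpr fun j => ?_
    rcases Fin.eq_castSucc_or_eq_last j with ⟨i, rfl⟩ | rfl
    · rw [hτ'c, show i.castSucc.succ = i.succ.castSucc from Fin.ext rfl, hτ'c]
      exact hτ (Fin.castSucc_lt_succ (i := i))
    · rw [hτ'c, Fin.succ_last, hτ'l]; exact hxsN
  · -- positivity
    intro j
    rcases Fin.eq_castSucc_or_eq_last j with ⟨i, rfl⟩ | rfl
    · rw [hτ'c]; exact hpos i
    · rw [hτ'l]; exact hxs0
  · -- nonvanishing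
    intro j
    rcases Fin.eq_castSucc_or_eq_last j with ⟨i, rfl⟩ | rfl
    · rw [hτ'c, hGs]
      intro h0
      have := htall i
      rw [h0, zero_mul] at this
      exact lt_irrefl 0 this
    · rw [hτ'l, hGs]
      intro h0
      rw [h0, zero_mul] at hxsL'
      exact lt_irrefl 0 hxsL'
  · -- alternation
    intro j
    rcases Fin.eq_castSucc_or_eq_last j with ⟨i, rfl⟩ | rfl
    · -- an old pair, signs carried
      rw [hτ'c, show i.castSucc.succ = i.succ.castSucc from Fin.ext rfl, hτ'c, hGs, hGs]
      exact mul_neg_of_carriers (htall i.castSucc) (htall i.succ) (halt i)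
    · -- the new pair `(τ N, x⋆)`
      rw [hτ'c, Fin.succ_last, hτ'l, hGs, hGs]
      exact mul_neg_of_carriers (htall (Fin.last N)) hxsL' (by rw [mul_comm]; exact hLdN)

/-- **Census corollary.**  A rank-one-topped `(2, K+1)` pencil with an `N`-alternation certificate refutes `PosRootLawAt 2 (K+1) N` — one
better than `Graft.not_posRootLawAt_of_alternating` gives for the pencil itself (`N − 1`). [folklore] -/
theorem not_posRootLawAt_of_tail_top {K N : ℕ} (d : Fin (K + 1) → ℕ) (S : Fin (K + 1) → Matrix (Fin 2) (Fin 2) ℝ)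
    (hd : StrictMono d) (hS : ∀ l, (S l).IsSymm)
    (hdet : (S (Fin.last K)).det = 0) (hne0 : S (Fin.last K) ≠ 0)
    (τ : Fin (N + 1) → ℝ) (hτ : StrictMono τ) (hpos : ∀ j, 0 < τ j)
    (hne : ∀ j, (∑ l, τ j ^ d l • S l).det ≠ 0)
    (halt : ∀ j : Fin N, (∑ l, τ j.castSucc ^ d l • S l).det * (∑ l, τ j.succ ^ d l • S l).det < 0) :
    ¬ Summit.ValiantsHypothesis.ValiantsHypothesis.Theorems.MatrixDescartes.Negative.PosRootLawAt 2 (K + 1) N := by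
  obtain ⟨s, τ', hS', hτ', hpos', -, halt'⟩ := exists_alternating_tail_top d S hd hS hdet hne0 τ hτ hpos hne halt
  have h := not_posRootLawAt_of_alternating (m := 2) (by omega) d _ hS' τ' hτ' hpos' halt'
  simpa using h

/-! ## 4. The tail graft at the bottom end (mirror: `x → 0⁺`) -/

/-- For `x → 0⁺`, `x^(d l) / x^(d 0) → [l = 0]` when `d` is strictly increasing. [folklore] -/
theorem tendsto_pow_div_bottom {K : ℕ} (d : Fin (K + 1) → ℕ) (hd : StrictMono d) (l : Fin (K + 1)) :
    Tendsto (fun x : ℝ => x ^ d l * (x ^ d 0)⁻¹) (𝓝[Set.Ioi 0] 0)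
      (𝓝 (if l = 0 then (1 : ℝ) else 0)) := by
  by_cases hl : l = 0
  · subst hl
    simp only [if_true]
    refine tendsto_const_nhds.congr' ?_
    filter_upwards [self_mem_nhdsWithin] with x hx
    rw [Set.mem_Ioi] at hx
    rw [mul_inv_cancel₀ (pow_ne_zero _ hx.ne')]
  · simp only [hl, if_false]
    have hlt : d 0 < d l := hd (lt_of_le_of_ne (Fin.zero_le l) (Ne.symm hl))
    have hk : d l - d 0 ≠ 0 := by omega
    have h0 : Tendsto (fun x : ℝ => x ^ (d l - d 0)) (𝓝[Set.Ioi 0] 0) (𝓝 0) := by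
      have h := ((continuous_pow (d l - d 0)).tendsto (0 : ℝ))
      rw [zero_pow hk] at h
      exact h.mono_left nhdsWithin_le_nhds
    refine h0.congr' ?_
    filter_upwards [self_mem_nhdsWithin] with x hx
    rw [Set.mem_Ioi] at hx
    rw [pow_sub₀ _ hx.ne' hlt.le]

/-- After division by `x^(d 0)` the pencil tends to its bottom letter as `x → 0⁺`. [folklore] -/
theorem tendsto_inv_pow_smul_pencil_bottom {K : ℕ} (d : Fin (K + 1) → ℕ) (hd : StrictMono d)
    (S : Fin (K + 1) → Matrix (Fin 2) (Fin 2) ℝ) :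
    Tendsto (fun x : ℝ => (x ^ d 0)⁻¹ • ∑ l, x ^ d l • S l) (𝓝[Set.Ioi 0] 0) (𝓝 (S 0)) := by
  have h : ∀ x : ℝ, (x ^ d 0)⁻¹ • (∑ l, x ^ d l • S l) = ∑ l, (x ^ d l * (x ^ d 0)⁻¹) • S l := by
    intro x
    rw [Finset.smul_sum]
    refine Finset.sum_congr rfl fun l _ => ?_
    rw [smul_smul, mul_comm]
  simp_rw [h]
  have hlim : S 0 = ∑ l, (if l = 0 then (1 : ℝ) else 0) • S l := by
    simp [ite_smul, Finset.sum_ite_eq']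
  rw [hlim]
  exact tendsto_finsetSum _ fun l _ => (tendsto_pow_div_bottom d hd l).smul_const _

/-- **THE TAIL GRAFT (m = 2, bottom end).**  A rank-one BOTTOM letter is worth one more alternation at the same format: thicken
`S 0` to `S 0 + s • 1`; the new test point is prepended below `τ 0`. [folklore] -/
theorem exists_alternating_tail_bottom {K N : ℕ} (d : Fin (K + 1) → ℕ) (S : Fin (K + 1) → Matrix (Fin 2) (Fin 2) ℝ)
    (hd : StrictMono d) (hS : ∀ l, (S l).IsSymm)
    (hdet : (S 0).det = 0) (hne0 : S 0 ≠ 0)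
    (τ : Fin (N + 1) → ℝ) (hτ : StrictMono τ) (hpos : ∀ j, 0 < τ j)
    (hne : ∀ j, (∑ l, τ j ^ d l • S l).det ≠ 0)
    (halt : ∀ j : Fin N, (∑ l, τ j.castSucc ^ d l • S l).det * (∑ l, τ j.succ ^ d l • S l).det < 0) :
    ∃ (s : ℝ) (τ' : Fin (N + 1 + 1) → ℝ),
      (∀ l, (Function.update S 0 (S 0 + s • (1 : Matrix (Fin 2) (Fin 2) ℝ)) l).IsSymm) ∧
      StrictMono τ' ∧ (∀ j, 0 < τ' j) ∧
      (∀ j, (∑ l, τ' j ^ d l • Function.update S 0 (S 0 + s • (1 : Matrix (Fin 2) (Fin 2) ℝ)) l).det ≠ 0) ∧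
      ∀ j : Fin (N + 1),
        (∑ l, τ' j.castSucc ^ d l • Function.update S 0 (S 0 + s • (1 : Matrix (Fin 2) (Fin 2) ℝ)) l).det *
        (∑ l, τ' j.succ ^ d l • Function.update S 0 (S 0 + s • (1 : Matrix (Fin 2) (Fin 2) ℝ)) l).det < 0 := by
  classical
  set J : Matrix (Fin 2) (Fin 2) ℝ := S 0 with hJ
  set D : ℕ := d 0 with hD
  set G : ℝ → Matrix (Fin 2) (Fin 2) ℝ := fun x => ∑ l, x ^ d l • S l with hG
  have hT : J.trace ≠ 0 := trace_ne_zero_of_det_eq_zero (hS _) hdet hne0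
  set dN : ℝ := (G (τ 0)).det with hdN
  have hdN0 : dN ≠ 0 := hne 0
  have hGs : ∀ s x : ℝ, (∑ l, x ^ d l • Function.update S 0 (S 0 + s • (1 : Matrix (Fin 2) (Fin 2) ℝ)) l)
      = G x + (s * x ^ D) • (1 : Matrix (Fin 2) (Fin 2) ℝ) := by
    intro s x
    rw [sum_smul_update_add, smul_smul, mul_comm]
  -- Step 1: small `t > 0`
  have hold : ∀ j : Fin (N + 1), ∀ᶠ t : ℝ in 𝓝 0,
      0 < (G (τ j) + ((-(t * (dN * J.trace))) * τ j ^ D) • (1 : Matrix (Fin 2) (Fin 2) ℝ)).det * (G (τ j)).det := by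
    intro j
    have hsc : Continuous fun t : ℝ => (-(t * (dN * J.trace))) * τ j ^ D :=
      (continuous_id.mul continuous_const).neg.mul continuous_const
    have hc : Continuous fun t : ℝ => (G (τ j) + ((-(t * (dN * J.trace))) * τ j ^ D) • (1 : Matrix (Fin 2) (Fin 2) ℝ)).det :=
      (continuous_const.add (hsc.smul continuous_const)).matrix_det
    have ht := hc.tendsto 0
    simp only [zero_mul, neg_zero, zero_smul, add_zero] at ht
    exact eventually_mul_pos_of_tendsto ht (hne j)
  have hone : ∀ᶠ t : ℝ in 𝓝 0, 0 < 1 - t * dN := by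
    have hc : Tendsto (fun t : ℝ => 1 - t * dN) (𝓝 0) (𝓝 1) := by
      have h := (tendsto_const_nhds (x := (1 : ℝ)) (f := 𝓝 (0 : ℝ))).sub
        ((Filter.tendsto_id (x := 𝓝 (0 : ℝ))).mul (tendsto_const_nhds (x := dN)))
      simpa using h
    have := eventually_mul_pos_of_tendsto hc one_ne_zero
    simpa using this
  obtain ⟨t, ⟨htall, ht1⟩, htpos⟩ :=
    ((((eventually_all.2 hold).and hone).filter_mono nhdsWithin_le_nhds).and
      (eventually_mem_nhdsWithin : ∀ᶠ t : ℝ in 𝓝[Set.Ioi 0] 0, t ∈ Set.Ioi 0)).exists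
  rw [Set.mem_Ioi] at htpos
  set s : ℝ := -(t * (dN * J.trace)) with hs
  set L : ℝ := (J + s • (1 : Matrix (Fin 2) (Fin 2) ℝ)).det with hL
  have hLval : L = s * (s + J.trace) := by
    rw [hL, det_add_smul_one_two, hdet]; ring
  have hLdN : L * dN < 0 := by
    rw [hLval, hs]
    have h1 : 0 < (dN * J.trace) * (dN * J.trace) := mul_self_pos.mpr (mul_ne_zero hdN0 hT)
    have key : 0 < t * ((dN * J.trace) * (dN * J.trace)) * (1 - t * dN) := mul_pos (mul_pos htpos h1) ht1
    have e : (-(t * (dN * J.trace))) * ((-(t * (dN * J.trace))) + J.trace) * dN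
        = -(t * ((dN * J.trace) * (dN * J.trace)) * (1 - t * dN)) := by ring
    rw [e]; linarith
  have hL0 : L ≠ 0 := fun h => by rw [h, zero_mul] at hLdN; exact lt_irrefl 0 hLdN
  -- Step 2: for this `s`, the sign of `det F_s(x)` as `x → 0⁺` is the sign of `L`
  have hlim : Tendsto (fun x : ℝ => ((x ^ D)⁻¹ • (G x + (s * x ^ D) • (1 : Matrix (Fin 2) (Fin 2) ℝ))).det)
      (𝓝[Set.Ioi 0] 0) (𝓝 L) := by
    have h1 : Tendsto (fun x : ℝ => (x ^ D)⁻¹ • G x + s • (1 : Matrix (Fin 2) (Fin 2) ℝ)) (𝓝[Set.Ioi 0] 0)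
        (𝓝 (J + s • (1 : Matrix (Fin 2) (Fin 2) ℝ))) :=
      (tendsto_inv_pow_smul_pencil_bottom d hd S).add tendsto_const_nhds
    have h2 := ((continuous_id.matrix_det).tendsto _).comp h1
    refine h2.congr' ?_
    filter_upwards [self_mem_nhdsWithin] with x hx
    rw [Set.mem_Ioi] at hx
    simp only [Function.comp, id]
    rw [smul_add, smul_smul, show (x ^ D)⁻¹ * (s * x ^ D) = s by field_simp]
  have hlt0 : ∀ᶠ x : ℝ in 𝓝[Set.Ioi 0] 0, x < τ 0 :=
    (eventually_lt_nhds (hpos 0)).filter_mono nhdsWithin_le_nhds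
  obtain ⟨xs, ⟨hxsL, hxsN⟩, hxs0⟩ :=
    (((eventually_mul_pos_of_tendsto hlim hL0).and hlt0).and
      (eventually_mem_nhdsWithin : ∀ᶠ x : ℝ in 𝓝[Set.Ioi 0] 0, x ∈ Set.Ioi 0)).exists
  rw [Set.mem_Ioi] at hxs0
  have hxsL' : 0 < (G xs + (s * xs ^ D) • (1 : Matrix (Fin 2) (Fin 2) ℝ)).det * L := by
    have hc : ((xs ^ D)⁻¹ • (G xs + (s * xs ^ D) • (1 : Matrix (Fin 2) (Fin 2) ℝ))).det
        = ((xs ^ D)⁻¹) ^ 2 * (G xs + (s * xs ^ D) • (1 : Matrix (Fin 2) (Fin 2) ℝ)).det := by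
      rw [Matrix.det_smul, Fintype.card_fin]
    rw [hc] at hxsL
    have hp : 0 < ((xs ^ D)⁻¹) ^ 2 := pow_pos (inv_pos.2 (pow_pos hxs0 _)) 2
    nlinarith [hxsL, hp, mul_pos hp hp]
  -- the new test points: `x⋆` prepended
  set τ' : Fin (N + 1 + 1) → ℝ := Fin.cons xs τ with hτ'
  have hτ's : ∀ j : Fin (N + 1), τ' j.succ = τ j := fun j => by simp [hτ']
  have hτ'0 : τ' 0 = xs := by simp [hτ']
  refine ⟨s, τ', ?_, ?_, ?_, ?_, ?_⟩
  · intro l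
    by_cases hl : l = 0
    · subst hl
      rw [Function.update_self]
      exact (hS _).add ((Matrix.isSymm_one).smul s)
    · rw [Function.update_of_ne hl]; exact hS l
  · refine Fin.strictMono_iff_lt_succ.mpr fun j => ?_
    rcases Fin.eq_zero_or_eq_succ j with rfl | ⟨i, rfl⟩
    · rw [Fin.castSucc_zero, hτ'0, hτ's]; exact hxsN
    · rw [show i.succ.castSucc = i.castSucc.succ from Fin.ext rfl, hτ's, hτ's]
      exact hτ (Fin.castSucc_lt_succ (i := i))
  · intro j
    rcases Fin.eq_zero_or_eq_succ j with rfl | ⟨i, rfl⟩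
    · rw [hτ'0]; exact hxs0
    · rw [hτ's]; exact hpos i
  · intro j
    rcases Fin.eq_zero_or_eq_succ j with rfl | ⟨i, rfl⟩
    · rw [hτ'0, hGs]
      intro h0
      rw [h0, zero_mul] at hxsL'
      exact lt_irrefl 0 hxsL'
    · rw [hτ's, hGs]
      intro h0
      have := htall i
      rw [h0, zero_mul] at this
      exact lt_irrefl 0 this
  · intro j
    rcases Fin.eq_zero_or_eq_succ j with rfl | ⟨i, rfl⟩
    · -- the new pair `(x⋆, τ 0)`
      rw [Fin.castSucc_zero, hτ'0, hτ's, hGs, hGs]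
      exact mul_neg_of_carriers hxsL' (htall 0) hLdN
    · rw [show i.succ.castSucc = i.castSucc.succ from Fin.ext rfl, hτ's, hτ's, hGs, hGs]
      exact mul_neg_of_carriers (htall i.castSucc) (htall i.succ) (halt i)

/-- **Census corollary (both ends).**  A `(2, K+1)` pencil whose bottom AND top letters have rank exactly one and which carries an
`N`-alternation certificate refutes `PosRootLawAt 2 (K+1) (N + 1)`: rank-one ENDS are worth `+2` at the same format.  (Needs `K ≥ 1`
so that the two end letters are distinct letters.) [folklore] -/
theorem not_posRootLawAt_of_tail_both {K N : ℕ} (hK : 1 ≤ K) (d : Fin (K + 1) → ℕ) (S : Fin (K + 1) → Matrix (Fin 2) (Fin 2) ℝ)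
    (hd : StrictMono d) (hS : ∀ l, (S l).IsSymm)
    (hdet0 : (S 0).det = 0) (hne00 : S 0 ≠ 0)
    (hdetl : (S (Fin.last K)).det = 0) (hne0l : S (Fin.last K) ≠ 0)
    (τ : Fin (N + 1) → ℝ) (hτ : StrictMono τ) (hpos : ∀ j, 0 < τ j)
    (hne : ∀ j, (∑ l, τ j ^ d l • S l).det ≠ 0)
    (halt : ∀ j : Fin N, (∑ l, τ j.castSucc ^ d l • S l).det * (∑ l, τ j.succ ^ d l • S l).det < 0) :
    ¬ Summit.ValiantsHypothesis.ValiantsHypothesis.Theorems.MatrixDescartes.Negative.PosRootLawAt 2 (K + 1) (N + 1) := by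
  have hl0 : (Fin.last K : Fin (K + 1)) ≠ 0 := by
    intro h
    have := congrArg Fin.val h
    simp at this
    omega
  -- thicken the bottom first
  obtain ⟨s, τ', hS', hτ', hpos', hne', halt'⟩ := exists_alternating_tail_bottom d S hd hS hdet0 hne00 τ hτ hpos hne halt
  set S' := Function.update S 0 (S 0 + s • (1 : Matrix (Fin 2) (Fin 2) ℝ)) with hS'd
  have htop : S' (Fin.last K) = S (Fin.last K) := by rw [hS'd, Function.update_of_ne hl0]
  -- then the top of the thickened pencil (its top letter is untouched)
  have h := not_posRootLawAt_of_tail_top d S' hd hS' (by rw [htop]; exact hdetl) (by rw [htop]; exact hne0l)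
    τ' hτ' hpos' hne' halt'
  simpa using h

end Summit.ValiantsHypothesis.ValiantsHypothesis.Cruxes.MatrixDescartes.TailGraft
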